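import Literature.Combinatorics.Words.Borders
import Literature.Combinatorics.Words.Primitivity
import Mathlib.Data.List.Lex
import HarnessLib

/-!
# Lyndon words and the factorization theorem of Chen, Fox and Lyndon (Lothaire, §5.1)

M. Lothaire, *Combinatorics on Words* [Lothaire1997], Chapter 5 (Factorizations of free monoids),
§5.1 "Lyndon words".  A total order on the alphabet `A` is extended to the **lexicographic order**
on words: `u < v` iff `v ∈ uA⁺`, or `u = ras`, `v = rbt` with letters `a < b`; the text records the
two properties

* (𝔏1) `∀ w, u < v ↔ wu < wv`;
* (𝔏2) if `v ∉ uA*` then `u < v ⇒ uw < vz` for all `w, z`.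

"By definition a **Lyndon word** is a primitive word that is minimal in its conjugate class …
Equivalently `l ∈ L` iff `∀ u, v ∈ A⁺, l = uv ⇒ l < vu`."  Example 5.1.1 lists the first Lyndon
words over `{a < b}`: `a, b, ab, aab, abb, aaab, aabb, abbb, aaaab, aaabb, aabab, …`.

* **Proposition 5.1.2.** `w ∈ A⁺` is a Lyndon word iff it is strictly smaller than each of its
  proper (nonempty) right factors.  (The proof first shows that a proper right factor of a Lyndon
  word is never a left factor of it: Lyndon words are unbordered.)
* **Proposition 5.1.3.** `w ∈ A⁺` is a Lyndon word iff `w ∈ A` or `w = lm` with `l, m ∈ L`, `l < m`.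
  More precisely, if `m` is the longest proper right factor of `w = lm ∈ L` that belongs to `L`,
  then `l ∈ L` and `l < lm < m`; the pair `σ(w) = (l, m)` is the **standard factorization** of `w`
  (example: `σ(aabb) = (a, abb)`, although also `aabb = (aab)(b)`).
* **Theorem 5.1.5 (Lyndon).** Any word `w ∈ A⁺` may be written uniquely as a nonincreasing product
  of Lyndon words `w = l₁ l₂ ⋯ lₙ`, `lᵢ ∈ L`, `l₁ ≥ l₂ ≥ ⋯ ≥ lₙ` — the Chen–Fox–Lyndon factorization
  [ChenFoxLyndon1958].
* **Proposition 5.1.6.** If `w = l₁ ⋯ lₙ` is that factorization, `lₙ` is the smallest right factor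
  of `w` ("iterating this process gives the factorization of `w`", from right to left).

Dictionary.  Words are `List α` over a linearly ordered alphabet `α`; the lexicographic order of the
text is Mathlib's order on `List α` (`List.Lex (· < ·)`, with `ε` below every nonempty word, which
is consistent with the text's order on `A⁺`); right factors are suffixes `<:+`, left factors are
prefixes `<+:`; conjugates are rotations (`List.rotate`, `List.IsRotated`, cf.
`Literature.Combinatorics.Words.isRotated_iff_exists_append`); primitivity is `IsPrimitive` and
powers are `wordPow` from `Literature.Combinatorics.Words.FineWilf`; borders are `IsBorder` from
`Literature.Combinatorics.Words.Borders`.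

## Main definitions and statements

* `lt_append_of_ne_nil` (`v ∈ uA⁺ ⇒ u < v`), `append_lt_append_left_iff` (𝔏1),
  `append_lt_append_of_not_prefix` (𝔏2).
* `IsLyndon w` — `w ≠ ε` and `w < vu` for every factorization `w = uv` into nonempty words, stated
  with rotations (decidable); `isLyndon_iff_forall_append` (the displayed form),
  `isPrimitive_iff_forall_rotate_ne` (a primitive word has `|w|` distinct conjugates, §1.3),
  `isLyndon_iff_isPrimitive` / `isLyndon_iff_isPrimitive_isRotated` (the definition: primitive and
  minimal among its conjugates).
* `IsLyndon.eq_of_prefix_of_suffix`, `IsLyndon.isBorder_iff` (Lyndon words are unbordered),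
  `IsLyndon.lt_of_suffix` and `isLyndon_iff_forall_suffix_lt` — Proposition 5.1.2.
* `IsLyndon.append_lt` (`l < m`, `m ∈ L` ⇒ `lm < m`), `IsLyndon.append` — Proposition 5.1.3 ("if");
  `longestLyndonSuffix`, `stdRight`, `stdLeft` (the standard factorization `σ(w) = (l, m)`),
  `isLyndon_stdLeft`, `stdLeft_lt_self`, `IsLyndon.lt_stdRight`, `IsLyndon.stdLeft_lt_stdRight`,
  `isLyndon_iff_exists_append` — Proposition 5.1.3.
* `minSuffix w` (the smallest nonempty right factor), `isLyndon_minSuffix`;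
  `lyndonFactorization w` (computed right to left as in Proposition 5.1.6),
  `flatten_lyndonFactorization`, `isLyndon_of_mem_lyndonFactorization`,
  `pairwise_lyndonFactorization` / `isChain_lyndonFactorization` (existence),
  `getLast_le_of_suffix`, `getLast_eq_minSuffix` (Proposition 5.1.6 for any nonincreasing
  factorization into Lyndon words), `eq_of_flatten_eq` (uniqueness), `eq_lyndonFactorization`,
  `existsUnique_lyndonFactorization` — Theorem 5.1.5; `IsLyndon.minSuffix_eq`,
  `IsLyndon.lyndonFactorization_eq` (a Lyndon word is its own factorization).
* Example 5.1.1, `σ(aabb) = (a, abb)` and a factorization, checked by `decide`.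

## References

* M. Lothaire, *Combinatorics on Words*, Cambridge Mathematical Library, Cambridge University Press
  (1997), §5.1: (𝔏1), (𝔏2), Example 5.1.1, Propositions 5.1.2, 5.1.3, 5.1.6, Theorem 5.1.5; §1.3
  (conjugates of a primitive word). [Lothaire1997]
* K. T. Chen, R. H. Fox, R. C. Lyndon, *Free differential calculus IV. The quotient groups of the
  lower central series*, Ann. of Math. 68 (1958) 81–95. [ChenFoxLyndon1958]
-/

namespace Literature.Combinatorics.Words

open List

variable {α : Type*} [LinearOrder α]

/-! ### The lexicographic order -/

/-- First clause of the definition of the lexicographic order: `v ∈ uA⁺` implies `u < v`, i.e.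
`u < ut` for nonempty `t`. [cite: Lothaire1997, §5.1 (lexicographic order)] -/
theorem lt_append_of_ne_nil (u : List α) {t : List α} (ht : t ≠ []) : u < u ++ t := by
  induction u with
  | nil =>
    obtain ⟨b, t', rfl⟩ := List.exists_cons_of_ne_nil ht
    exact List.nil_lt_cons b t'
  | cons a u ih => exact List.cons_lt_cons_iff.2 (Or.inr ⟨rfl, ih⟩)

/-- A left factor is smaller than or equal to the word: `u ≤ ut`.
[cite: Lothaire1997, §5.1 (lexicographic order)] -/
theorem self_le_append (u t : List α) : u ≤ u ++ t := by
  rcases eq_or_ne t [] with rfl | ht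
  · rw [List.append_nil]
  · exact (lt_append_of_ne_nil u ht).le

/-- A left factor is smaller than or equal to the word. [cite: Lothaire1997, §5.1 (lexicographic
order)] -/
theorem le_of_prefix {u v : List α} (h : u <+: v) : u ≤ v := by
  obtain ⟨t, rfl⟩ := h
  exact self_le_append u t

/-- **(𝔏1)** `wu < wv ↔ u < v`. [cite: Lothaire1997, §5.1 (𝔏1)] -/
theorem append_lt_append_left_iff (w : List α) {u v : List α} : w ++ u < w ++ v ↔ u < v := by
  induction w with
  | nil => exact Iff.rfl
  | cons a w ih =>
    rw [List.cons_append, List.cons_append, List.cons_lt_cons_iff]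
    simp [ih]

/-- **(𝔏2)** If `v ∉ uA*` (that is, `u` is not a left factor of `v`) and `u < v`, then `uw < vz` for
all words `w`, `z`. [cite: Lothaire1997, §5.1 (𝔏2)] -/
theorem append_lt_append_of_not_prefix :
    ∀ {u v : List α}, ¬u <+: v → u < v → ∀ w z : List α, u ++ w < v ++ z
  | [], v, hp, _, _, _ => absurd (List.nil_prefix) hp
  | a :: u, [], _, h, _, _ => absurd h (List.not_lt_nil _)
  | a :: u, b :: v, hp, h, w, z => by
    rw [List.cons_append, List.cons_append, List.cons_lt_cons_iff]
    rcases List.cons_lt_cons_iff.1 h with hab | ⟨rfl, huv⟩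
    · exact Or.inl hab
    · exact Or.inr
        ⟨rfl, append_lt_append_of_not_prefix (fun hp' => hp (by simpa using hp')) huv w z⟩

/-- Words of equal length that compare as `u < v` differ at some letter, so `uw < vz` for all
`w`, `z` (a case of (𝔏2)). [cite: Lothaire1997, §5.1 (𝔏2)] -/
theorem append_lt_append_of_length_eq {u v : List α} (hl : u.length = v.length) (h : u < v)
    (w z : List α) : u ++ w < v ++ z :=
  append_lt_append_of_not_prefix
    (fun hp => absurd h (by rw [hp.eq_of_length hl]; exact lt_irrefl v)) h w z

omit [LinearOrder α] in
/-- `v ≠ uv` for nonempty `u`. [folklore] -/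
private theorem ne_append_left_of_ne_nil {u : List α} (v : List α) (hu : u ≠ []) : v ≠ u ++ v :=
  fun h => by
    have h1 := congrArg List.length h
    rw [List.length_append] at h1
    have h2 := List.length_pos_of_ne_nil hu
    omega

omit [LinearOrder α] in
/-- `u ≠ uv` for nonempty `v`. [folklore] -/
private theorem ne_append_right_of_ne_nil (u : List α) {v : List α} (hv : v ≠ []) : u ≠ u ++ v :=
  fun h => by
    have h1 := congrArg List.length h
    rw [List.length_append] at h1
    have h2 := List.length_pos_of_ne_nil hv
    omega

/-! ### Lyndon words -/

/-- A **Lyndon word**: a nonempty word strictly smaller than each of its nontrivial conjugates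
(rotations), i.e. `w = uv` with `u, v ∈ A⁺` implies `w < vu`.
[cite: Lothaire1997, §5.1 (definition of Lyndon words)] -/
def IsLyndon (w : List α) : Prop :=
  w ≠ [] ∧ ∀ k < w.length, 0 < k → w < w.rotate k

/-- `IsLyndon` is decidable. [cite: Lothaire1997, §5.1 (definition of Lyndon words)] -/
instance instDecidablePredIsLyndon : DecidablePred (IsLyndon : List α → Prop) := fun w =>
  show Decidable (w ≠ [] ∧ ∀ k < w.length, 0 < k → w < w.rotate k) from inferInstance

/-- The displayed form of the definition: `l ∈ L` iff `l ≠ ε` and `l = uv` with `u, v ∈ A⁺` implies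
`l < vu`. [cite: Lothaire1997, §5.1 (definition of Lyndon words)] -/
theorem isLyndon_iff_forall_append {w : List α} :
    IsLyndon w ↔ w ≠ [] ∧ ∀ u v : List α, u ≠ [] → v ≠ [] → w = u ++ v → u ++ v < v ++ u := by
  constructor
  · rintro ⟨hw, h⟩
    refine ⟨hw, fun u v hu hv huv => ?_⟩
    have hk : u.length < w.length := by
      rw [huv, List.length_append]
      have := List.length_pos_of_ne_nil hv
      omega
    have h1 := h u.length hk (List.length_pos_of_ne_nil hu)
    rwa [huv, List.rotate_append_length_eq] at h1
  · rintro ⟨hw, h⟩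
    refine ⟨hw, fun k hk hk0 => ?_⟩
    have h1 := h (w.take k) (w.drop k)
      (List.ne_nil_of_length_pos (by rw [List.length_take]; exact lt_min hk0 (by omega)))
      (fun h0 => by have := List.drop_eq_nil_iff.1 h0; omega) (List.take_append_drop k w).symm
    rw [List.rotate_eq_drop_append_take hk.le]
    rwa [List.take_append_drop] at h1

/-- The empty word is not a Lyndon word (`L ⊆ A⁺`). [cite: Lothaire1997, §5.1 (definition of Lyndon
words)] -/
theorem not_isLyndon_nil : ¬IsLyndon ([] : List α) := fun h => h.1 rfl

/-- Letters are Lyndon words ("the letters are elements of `L`").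
[cite: Lothaire1997, §5.1 (proof of Theorem 5.1.5)] -/
theorem isLyndon_singleton (a : α) : IsLyndon [a] :=
  ⟨List.cons_ne_nil a [], fun k hk hk0 => by rw [List.length_singleton] at hk; omega⟩

omit [LinearOrder α] in
/-- A nonempty word is primitive iff it differs from each of its nontrivial conjugates (a primitive
word `z` "has `|z|` distinct conjugates").
[cite: Lothaire1997, §1.3 (proof of Proposition 1.3.3)] -/
theorem isPrimitive_iff_forall_rotate_ne {w : List α} (hw : w ≠ []) :
    IsPrimitive w ↔ ∀ k, 0 < k → k < w.length → w.rotate k ≠ w := by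
  constructor
  · intro hp k hk0 hk heq
    have huv : w.drop k ++ w.take k = w.take k ++ w.drop k := by
      rw [List.take_append_drop, ← List.rotate_eq_drop_append_take hk.le, heq]
    obtain ⟨z, m, n, hd, ht⟩ := append_comm_iff_exists_wordPow.1 huv
    have hwz : w = wordPow z (n + m) := by rw [wordPow_add, ← ht, ← hd, List.take_append_drop]
    have hz : z = w := hp.2 z (n + m) hwz
    have hlen := congrArg List.length ht
    rw [List.length_take, length_wordPow, hz] at hlen
    rcases n with _ | n
    · rw [Nat.zero_mul] at hlen
      omega
    · have h1 : 0 < (n + 1) * w.length := Nat.mul_pos (Nat.succ_pos n) (by omega)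
      rw [Nat.succ_mul] at hlen h1
      omega
  · intro h
    by_contra hp
    obtain ⟨z, k, hz, hk, rfl⟩ := (not_isPrimitive_iff hw).1 hp
    obtain ⟨j, rfl⟩ : ∃ j, k = j + 1 := ⟨k - 1, by omega⟩
    have hzl := List.length_pos_of_ne_nil hz
    refine h z.length hzl ?_ ?_
    · have h1 : 0 < j * z.length := Nat.mul_pos (by omega) hzl
      rw [length_wordPow, Nat.succ_mul]
      omega
    · conv_lhs => rw [wordPow_succ, List.rotate_append_length_eq]
      exact (wordPow_succ' z j).symm

/-- **The definition of the text**: a Lyndon word is a primitive word that is minimal in its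
conjugate class (rotation form). [cite: Lothaire1997, §5.1 (definition of Lyndon words)] -/
theorem isLyndon_iff_isPrimitive {w : List α} :
    IsLyndon w ↔ IsPrimitive w ∧ ∀ k, w ≤ w.rotate k := by
  constructor
  · rintro ⟨hw, h⟩
    have hrot : ∀ k, 0 < k → k < w.length → w.rotate k ≠ w := fun k hk0 hk heq =>
      absurd (h k hk hk0) (by rw [heq]; exact lt_irrefl w)
    refine ⟨(isPrimitive_iff_forall_rotate_ne hw).2 hrot, fun k => ?_⟩
    rw [← List.rotate_mod]
    rcases Nat.eq_zero_or_pos (k % w.length) with h0 | h0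
    · rw [h0, List.rotate_zero]
    · exact (h _ (Nat.mod_lt _ (List.length_pos_of_ne_nil hw)) h0).le
  · rintro ⟨hp, h⟩
    exact ⟨hp.1, fun k hk hk0 => lt_of_le_of_ne (h k) fun heq =>
      (isPrimitive_iff_forall_rotate_ne hp.1).1 hp k hk0 hk heq.symm⟩

/-- **The definition of the text**, with conjugacy as `List.IsRotated`: a Lyndon word is a primitive
word that is minimal in its conjugate class.
[cite: Lothaire1997, §5.1 (definition of Lyndon words)] -/
theorem isLyndon_iff_isPrimitive_isRotated {w : List α} :
    IsLyndon w ↔ IsPrimitive w ∧ ∀ w' : List α, w ~r w' → w ≤ w' := by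
  rw [isLyndon_iff_isPrimitive]
  refine and_congr_right fun _ => ⟨fun h w' hr => ?_, fun h k => h _ ⟨k, rfl⟩⟩
  obtain ⟨k, rfl⟩ := hr
  exact h k

/-- A Lyndon word is primitive. [cite: Lothaire1997, §5.1 (definition of Lyndon words)] -/
theorem IsLyndon.isPrimitive {w : List α} (hw : IsLyndon w) : IsPrimitive w :=
  (isLyndon_iff_isPrimitive.1 hw).1

/-- A Lyndon word is minimal among its conjugates. [cite: Lothaire1997, §5.1 (definition of Lyndon
words)] -/
theorem IsLyndon.le_rotate {w : List α} (hw : IsLyndon w) (k : ℕ) : w ≤ w.rotate k :=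
  (isLyndon_iff_isPrimitive.1 hw).2 k

/-! ### Proposition 5.1.2: a Lyndon word is smaller than its proper right factors -/

/-- First step of the proof of Proposition 5.1.2: a proper nonempty right factor `v` of a Lyndon
word `w` "cannot be a left factor of `w`" — a nonempty word that is both a left and a right factor
of a Lyndon word is the whole word. [cite: Lothaire1997, Proposition 5.1.2 (proof)] -/
theorem IsLyndon.eq_of_prefix_of_suffix {w v : List α} (hw : IsLyndon w) (hp : v <+: w)
    (hs : v <:+ w) (hv : v ≠ []) : v = w := by
  by_contra hne
  have hlt : v.length < w.length := lt_of_le_of_ne hp.length_le fun h => hne (hp.eq_of_length h)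
  have h2 := (isLyndon_iff_forall_append.1 hw).2
  obtain ⟨t, rfl⟩ := hp
  obtain ⟨u, hu⟩ := hs
  have ht : t ≠ [] := by
    rintro rfl
    rw [List.append_nil] at hlt
    exact lt_irrefl _ hlt
  have hu0 : u ≠ [] := by
    rintro rfl
    rw [List.nil_append] at hu
    exact hne hu
  have hlen : t.length = u.length := by
    have h1 := congrArg List.length hu
    rw [List.length_append, List.length_append] at h1
    omega
  have hB := h2 u v hu0 hv hu.symm
  rw [hu, append_lt_append_left_iff] at hB
  have h1 := append_lt_append_of_length_eq hlen hB v v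
  rw [hu] at h1
  exact lt_asymm h1 (h2 v t hv ht rfl)

/-- Lyndon words are unbordered: the only border of a Lyndon word is `ε`.
[cite: Lothaire1997, Proposition 5.1.2 (proof)] -/
theorem IsLyndon.isBorder_iff {w u : List α} (hw : IsLyndon w) : IsBorder u w ↔ u = [] := by
  constructor
  · intro h
    by_contra hu
    have := hw.eq_of_prefix_of_suffix h.1 h.2.1 hu
    have h3 := h.2.2
    rw [this] at h3
    exact lt_irrefl _ h3
  · rintro rfl
    exact nil_isBorder hw.1

/-- **Proposition 5.1.2** (⇒): a Lyndon word is strictly smaller than each of its proper nonempty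
right factors. [cite: Lothaire1997, Proposition 5.1.2] -/
theorem IsLyndon.lt_of_suffix {w v : List α} (hw : IsLyndon w) (hs : v <:+ w) (hv : v ≠ [])
    (hne : v ≠ w) : w < v := by
  obtain ⟨u, rfl⟩ := hs
  have hu : u ≠ [] := by
    rintro rfl
    exact hne (List.nil_append v).symm
  rcases lt_trichotomy (u ++ v) v with h | h | h
  · exact h
  · exact absurd h.symm hne
  · exfalso
    by_cases hp : v <+: u ++ v
    · exact hne (hw.eq_of_prefix_of_suffix hp (List.suffix_append u v) hv)
    · have h1 := append_lt_append_of_not_prefix hp h u []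
      rw [List.append_nil] at h1
      exact lt_asymm h1 ((isLyndon_iff_forall_append.1 hw).2 u v hu hv rfl)

/-- **Proposition 5.1.2.** A nonempty word is a Lyndon word iff it is strictly smaller than each of
its proper nonempty right factors: `w ∈ L ⟺ ∀ v ∈ A⁺, w ∈ A⁺v ⇒ w < v`.
[cite: Lothaire1997, Proposition 5.1.2] -/
theorem isLyndon_iff_forall_suffix_lt {w : List α} :
    IsLyndon w ↔ w ≠ [] ∧ ∀ v : List α, v <:+ w → v ≠ [] → v ≠ w → w < v := by
  constructor
  · exact fun hw => ⟨hw.1, fun v hs hv hne => hw.lt_of_suffix hs hv hne⟩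
  · rintro ⟨hw, h⟩
    refine isLyndon_iff_forall_append.2 ⟨hw, fun u v hu hv huv => ?_⟩
    have hvw : v ≠ w := fun he => ne_append_left_of_ne_nil v hu (he.trans huv)
    calc u ++ v = w := huv.symm
      _ < v := h v (huv ▸ List.suffix_append u v) hv hvw
      _ ≤ v ++ u := self_le_append v u

/-! ### Proposition 5.1.3: products of Lyndon words and the standard factorization -/

/-- "We note first that `lm < m`" — for `m ∈ L` and a nonempty `l < m`.
[cite: Lothaire1997, Proposition 5.1.3 (proof)] -/
theorem IsLyndon.append_lt {l m : List α} (hm : IsLyndon m) (hl : l ≠ []) (h : l < m) :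
    l ++ m < m := by
  by_cases hp : l <+: m
  · obtain ⟨m', rfl⟩ := hp
    have hm' : m' ≠ [] := by
      rintro rfl
      rw [List.append_nil] at h
      exact lt_irrefl l h
    exact (append_lt_append_left_iff l).2
      (hm.lt_of_suffix (List.suffix_append l m') hm' (ne_append_left_of_ne_nil m' hl))
  · simpa using append_lt_append_of_not_prefix hp h m []

/-- **Proposition 5.1.3** ("if"): if `l, m ∈ L` and `l < m` then `lm ∈ L`.
[cite: Lothaire1997, Proposition 5.1.3] -/
theorem IsLyndon.append {l m : List α} (hl : IsLyndon l) (hm : IsLyndon m) (h : l < m) :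
    IsLyndon (l ++ m) := by
  have hlm : l ++ m < m := hm.append_lt hl.1 h
  refine isLyndon_iff_forall_suffix_lt.2 ⟨by simp [hl.1], fun v hs hv hne => ?_⟩
  obtain ⟨t, ht⟩ := hs
  rcases List.append_eq_append_iff.1 ht with ⟨a', rfl, rfl⟩ | ⟨c', rfl, rfl⟩
  · -- `v = a' m` with `a'` a right factor of `l = t a'`
    rcases eq_or_ne a' [] with rfl | ha'
    · simpa using hlm
    · have ht0 : t ≠ [] := by
        rintro rfl
        exact hne (by simp)
      have h1 : t ++ a' < a' :=
        hl.lt_of_suffix (List.suffix_append t a') ha' (ne_append_left_of_ne_nil a' ht0)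
      have h2 : ¬t ++ a' <+: a' := fun hp => by
        have := hp.length_le
        rw [List.length_append] at this
        have := List.length_pos_of_ne_nil ht0
        omega
      simpa [List.append_assoc] using append_lt_append_of_not_prefix h2 h1 m m
  · -- `m = c' v`: `v` is a right factor of `m`
    rcases eq_or_ne c' [] with rfl | hc'
    · simpa using hlm
    · exact hlm.trans
        (hm.lt_of_suffix (List.suffix_append c' v) hv (ne_append_left_of_ne_nil v hc'))

/-- The longest right factor of `v` that is a Lyndon word (`ε` iff `v = ε`, since the last letter of
a nonempty word is in `L`). [cite: Lothaire1997, Proposition 5.1.3 (proof)] -/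
def longestLyndonSuffix : List α → List α
  | [] => []
  | a :: v => if IsLyndon (a :: v) then a :: v else longestLyndonSuffix v

/-- `longestLyndonSuffix v` is a right factor of `v`.
[cite: Lothaire1997, Proposition 5.1.3 (proof)] -/
theorem longestLyndonSuffix_suffix : ∀ v : List α, longestLyndonSuffix v <:+ v
  | [] => by rw [longestLyndonSuffix]
  | a :: v => by
    rw [longestLyndonSuffix.eq_2]
    split_ifs with h
    · exact List.suffix_refl _
    · exact (longestLyndonSuffix_suffix v).trans (List.suffix_cons a v)

/-- For nonempty `v`, `longestLyndonSuffix v` is a Lyndon word ("it exists since the last letter of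
`w` is in `L`"). [cite: Lothaire1997, Proposition 5.1.3 (proof)] -/
theorem isLyndon_longestLyndonSuffix : ∀ {v : List α}, v ≠ [] → IsLyndon (longestLyndonSuffix v)
  | [a], _ => by
    rw [longestLyndonSuffix.eq_2, if_pos (isLyndon_singleton a)]
    exact isLyndon_singleton a
  | a :: b :: v, _ => by
    rw [longestLyndonSuffix.eq_2]
    split_ifs with h
    · exact h
    · exact isLyndon_longestLyndonSuffix (List.cons_ne_nil b v)

/-- Maximality: every right factor of `v` in `L` is at most as long as `longestLyndonSuffix v`.
[cite: Lothaire1997, Proposition 5.1.3 (proof)] -/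
theorem length_le_longestLyndonSuffix :
    ∀ {v s : List α}, s <:+ v → IsLyndon s → s.length ≤ (longestLyndonSuffix v).length
  | [], s, hs, hL => absurd (List.suffix_nil.1 hs) hL.1
  | a :: v, s, hs, hL => by
    rw [longestLyndonSuffix.eq_2]
    split_ifs with h
    · exact hs.length_le
    · rcases List.suffix_cons_iff.1 hs with rfl | hs'
      · exact absurd hL h
      · exact length_le_longestLyndonSuffix hs' hL

/-- The right factor `m` of the standard factorization `σ(w) = (l, m)`: the proper right factor of
`w` of maximal length that belongs to `L` (`ε` for `w = ε`).
[cite: Lothaire1997, §5.1 (standard factorization)] -/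
def stdRight : List α → List α
  | [] => []
  | _ :: v => longestLyndonSuffix v

/-- The left factor `l` of the standard factorization `σ(w) = (l, m)`, `w = lm`.
[cite: Lothaire1997, §5.1 (standard factorization)] -/
def stdLeft (w : List α) : List α :=
  w.take (w.length - (stdRight w).length)

/-- `stdRight w` is a right factor of `w`. [cite: Lothaire1997, §5.1 (standard factorization)] -/
theorem stdRight_suffix : ∀ w : List α, stdRight w <:+ w
  | [] => by rw [stdRight]
  | a :: v => (longestLyndonSuffix_suffix v).trans (List.suffix_cons a v)

/-- `stdRight w` is a proper right factor of a nonempty `w`.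
[cite: Lothaire1997, §5.1 (standard factorization)] -/
theorem length_stdRight_lt : ∀ {w : List α}, w ≠ [] → (stdRight w).length < w.length
  | a :: v, _ => by
    rw [stdRight, List.length_cons]
    exact Nat.lt_succ_of_le (longestLyndonSuffix_suffix v).length_le

/-- `w = lm` for `σ(w) = (l, m)`. [cite: Lothaire1997, §5.1 (standard factorization)] -/
theorem stdLeft_append_stdRight (w : List α) : stdLeft w ++ stdRight w = w := by
  have hs := stdRight_suffix w
  rw [List.suffix_iff_eq_drop] at hs
  conv_rhs => rw [← List.take_append_drop (w.length - (stdRight w).length) w]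
  rw [stdLeft, ← hs]

/-- The left factor of `σ(w)` is nonempty for nonempty `w`.
[cite: Lothaire1997, §5.1 (standard factorization)] -/
theorem stdLeft_ne_nil {w : List α} (hw : w ≠ []) : stdLeft w ≠ [] :=
  List.ne_nil_of_length_pos (by
    rw [stdLeft, List.length_take]
    have := length_stdRight_lt hw
    exact lt_min (by omega) (List.length_pos_of_ne_nil hw))

/-- For `|w| ≥ 2` the right factor of `σ(w)` is a Lyndon word (the last letter of `w` is in `L`).
[cite: Lothaire1997, §5.1 (standard factorization)] -/
theorem isLyndon_stdRight : ∀ {w : List α}, 2 ≤ w.length → IsLyndon (stdRight w)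
  | [], h => absurd h (by simp)
  | [_], h => absurd h (by simp)
  | _ :: b :: v, _ => isLyndon_longestLyndonSuffix (List.cons_ne_nil b v)

/-- Maximality of the right factor of `σ(w)`: every proper right factor of `w` in `L` is at most as
long. [cite: Lothaire1997, §5.1 (standard factorization)] -/
theorem length_le_stdRight :
    ∀ {w s : List α}, s <:+ w → s.length < w.length → IsLyndon s → s.length ≤ (stdRight w).length
  | [], s, hs, _, hL => absurd (List.suffix_nil.1 hs) hL.1
  | a :: v, s, hs, hlt, hL => by
    rw [stdRight]
    rcases List.suffix_cons_iff.1 hs with rfl | hs'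
    · exact absurd rfl (Nat.ne_of_lt hlt)
    · exact length_le_longestLyndonSuffix hs' hL

/-- **Proposition 5.1.3** ("more precisely"): if `m` is the proper right factor of maximal length of
`w = lm ∈ L` that belongs to `L`, then `l ∈ L`. [cite: Lothaire1997, Proposition 5.1.3] -/
theorem isLyndon_stdLeft {w : List α} (hw : IsLyndon w) (h2 : 2 ≤ w.length) :
    IsLyndon (stdLeft w) := by
  have hlm : stdLeft w ++ stdRight w = w := stdLeft_append_stdRight w
  have hm : IsLyndon (stdRight w) := isLyndon_stdRight h2
  refine isLyndon_iff_forall_suffix_lt.2 ⟨stdLeft_ne_nil hw.1, fun v hs hv hne => ?_⟩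
  -- `vm` is a proper right factor of `w`, longer than `m`, hence not in `L`
  have hvm : v ++ stdRight w <:+ w := by
    obtain ⟨r, hr⟩ := hs
    exact ⟨r, by rw [← List.append_assoc, hr, hlm]⟩
  have hvl : v.length < (stdLeft w).length :=
    lt_of_le_of_ne hs.length_le fun he => hne (hs.eq_of_length he)
  have hwlen := congrArg List.length hlm
  rw [List.length_append] at hwlen
  have hnot : ¬IsLyndon (v ++ stdRight w) := fun hL => by
    have h1 := length_le_stdRight hvm (by rw [List.length_append]; omega) hL
    rw [List.length_append] at h1
    have := List.length_pos_of_ne_nil hv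
    omega
  -- so `vm` has a proper nonempty right factor `t` with `t < vm` (Proposition 5.1.2)
  obtain ⟨t, hts, ht0, htne, hlt⟩ : ∃ t, t <:+ v ++ stdRight w ∧ t ≠ [] ∧ t ≠ v ++ stdRight w ∧
      ¬v ++ stdRight w < t := by
    by_contra hc
    refine hnot (isLyndon_iff_forall_suffix_lt.2 ⟨by simp [hv], fun t hts ht0 htne => ?_⟩)
    by_contra hlt
    exact hc ⟨t, hts, ht0, htne, hlt⟩
  have htlt : t < v ++ stdRight w := lt_of_le_of_ne (not_lt.1 hlt) htne
  -- `t ≤ v`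
  have htv : t ≤ v := by
    by_contra hc
    rw [not_le] at hc
    by_cases hp : v <+: t
    · obtain ⟨s, rfl⟩ := hp
      have hs0 : s ≠ [] := by
        rintro rfl
        rw [List.append_nil] at hc
        exact lt_irrefl v hc
      have hsm : s < stdRight w := (append_lt_append_left_iff v).1 htlt
      have hsuf : s <:+ stdRight w :=
        List.suffix_of_suffix_length_le ((List.suffix_append v s).trans hts)
          (List.suffix_append v (stdRight w)) (by
            have h1 := hts.length_le
            rw [List.length_append, List.length_append] at h1
            omega)
      have hsne : s ≠ stdRight w := fun he => by
        rw [he] at hsm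
        exact lt_irrefl _ hsm
      exact lt_asymm hsm (hm.lt_of_suffix hsuf hs0 hsne)
    · have h1 := append_lt_append_of_not_prefix hp hc (stdRight w) []
      rw [List.append_nil] at h1
      exact lt_asymm h1 htlt
  -- `l < lm = w < t ≤ v`
  have h1 : stdLeft w < w := by
    conv_rhs => rw [← hlm]
    exact lt_append_of_ne_nil _ hm.1
  have h2 : w < t := hw.lt_of_suffix (hts.trans hvm) ht0 fun he =>
    htne (hts.eq_of_length (le_antisymm hts.length_le (by rw [he]; exact hvm.length_le)))
  exact (h1.trans h2).trans_le htv

/-- `l < lm` for the standard factorization (indeed for any nonempty `m`).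
[cite: Lothaire1997, Proposition 5.1.3] -/
theorem stdLeft_lt_self {w : List α} (h2 : 2 ≤ w.length) : stdLeft w < w := by
  conv_rhs => rw [← stdLeft_append_stdRight w]
  exact lt_append_of_ne_nil _ (isLyndon_stdRight h2).1

/-- `lm < m` for the standard factorization `σ(w) = (l, m)` of `w ∈ L`.
[cite: Lothaire1997, Proposition 5.1.3] -/
theorem IsLyndon.lt_stdRight {w : List α} (hw : IsLyndon w) (h2 : 2 ≤ w.length) :
    w < stdRight w :=
  hw.lt_of_suffix (stdRight_suffix w) (isLyndon_stdRight h2).1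
    fun he => absurd (congrArg List.length he) (Nat.ne_of_lt (length_stdRight_lt hw.1))

/-- `l < m` for the standard factorization `σ(w) = (l, m)` of `w ∈ L`.
[cite: Lothaire1997, Proposition 5.1.3] -/
theorem IsLyndon.stdLeft_lt_stdRight {w : List α} (hw : IsLyndon w) (h2 : 2 ≤ w.length) :
    Words.stdLeft w < stdRight w :=
  (stdLeft_lt_self h2).trans (hw.lt_stdRight h2)

/-- **Proposition 5.1.3.** `w ∈ A⁺` is a Lyndon word iff `w ∈ A` or `w = lm` with `l, m ∈ L` and
`l < m`. [cite: Lothaire1997, Proposition 5.1.3] -/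
theorem isLyndon_iff_exists_append {w : List α} :
    IsLyndon w ↔ (∃ a, w = [a]) ∨ ∃ l m, IsLyndon l ∧ IsLyndon m ∧ l < m ∧ w = l ++ m := by
  constructor
  · intro hw
    by_cases h2 : 2 ≤ w.length
    · exact Or.inr ⟨stdLeft w, stdRight w, isLyndon_stdLeft hw h2, isLyndon_stdRight h2,
        hw.stdLeft_lt_stdRight h2, (stdLeft_append_stdRight w).symm⟩
    · left
      match w, hw.1, h2 with
      | [a], _, _ => exact ⟨a, rfl⟩
      | _ :: _ :: _, _, h2 => exact absurd (by simp) h2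
  · rintro (⟨a, rfl⟩ | ⟨l, m, hl, hm, hlt, rfl⟩)
    · exact isLyndon_singleton a
    · exact hl.append hm hlt

/-! ### Theorem 5.1.5 and Proposition 5.1.6: the Chen–Fox–Lyndon factorization -/

/-- The smallest nonempty right factor of a word (`ε` for `ε`).
[cite: Lothaire1997, Proposition 5.1.6] -/
def minSuffix : List α → List α
  | [] => []
  | [a] => [a]
  | a :: b :: v => min (a :: b :: v) (minSuffix (b :: v))

/-- `minSuffix w` is a right factor of `w`. [cite: Lothaire1997, Proposition 5.1.6] -/
theorem minSuffix_suffix : ∀ w : List α, minSuffix w <:+ w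
  | [] => by rw [minSuffix]
  | [a] => by rw [minSuffix]
  | a :: b :: v => by
    rw [minSuffix]
    exact min_rec' (fun x => x <:+ a :: b :: v) (List.suffix_refl _)
      ((minSuffix_suffix (b :: v)).trans (List.suffix_cons a _))

/-- `minSuffix w` is nonempty for nonempty `w`. [cite: Lothaire1997, Proposition 5.1.6] -/
theorem minSuffix_ne_nil : ∀ {w : List α}, w ≠ [] → minSuffix w ≠ []
  | [a], _ => by rw [minSuffix]; exact List.cons_ne_nil a []
  | a :: b :: v, _ => by
    rw [minSuffix]
    exact min_rec' (fun x => x ≠ []) (List.cons_ne_nil a _)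
      (minSuffix_ne_nil (List.cons_ne_nil b v))

/-- `minSuffix w` is smaller than or equal to every nonempty right factor of `w`.
[cite: Lothaire1997, Proposition 5.1.6] -/
theorem minSuffix_le : ∀ {w v : List α}, v <:+ w → v ≠ [] → minSuffix w ≤ v
  | [], v, hs, hv => absurd (List.suffix_nil.1 hs) hv
  | [a], v, hs, hv => by
    rw [minSuffix]
    rcases List.suffix_cons_iff.1 hs with rfl | hs'
    · exact le_rfl
    · exact absurd (List.suffix_nil.1 hs') hv
  | a :: b :: u, v, hs, hv => by
    rw [minSuffix]
    rcases List.suffix_cons_iff.1 hs with rfl | hs'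
    · exact min_le_left _ _
    · exact (min_le_right _ _).trans (minSuffix_le hs' hv)

/-- Characterization of `minSuffix w` as the smallest nonempty right factor.
[cite: Lothaire1997, Proposition 5.1.6] -/
theorem eq_minSuffix {w m : List α} (hs : m <:+ w) (hm : m ≠ []) (hmin : ∀ v : List α, v <:+ w →
    v ≠ [] → m ≤ v) : m = minSuffix w :=
  le_antisymm
    (hmin _ (minSuffix_suffix w)
      (minSuffix_ne_nil (by rintro rfl; exact hm (List.suffix_nil.1 hs))))
    (minSuffix_le hs hm)

/-- "`v ∈ L` by 5.1.2": the smallest nonempty right factor of a nonempty word is a Lyndon word.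
[cite: Lothaire1997, Proposition 5.1.6 (proof)] -/
theorem isLyndon_minSuffix {w : List α} (hw : w ≠ []) : IsLyndon (minSuffix w) :=
  isLyndon_iff_forall_suffix_lt.2 ⟨minSuffix_ne_nil hw, fun _ hs hv hne =>
    lt_of_le_of_ne (minSuffix_le (hs.trans (minSuffix_suffix w)) hv) (Ne.symm hne)⟩

/-- The factorization of Proposition 5.1.6 with fuel: split off the smallest nonempty right factor
and iterate on what is left. [cite: Lothaire1997, Proposition 5.1.6 (proof)] -/
def lyndonFactorAux : ℕ → List α → List (List α)
  | 0, _ => []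
  | n + 1, w =>
    if w = [] then [] else
      lyndonFactorAux n (w.take (w.length - (minSuffix w).length)) ++ [minSuffix w]

/-- **The factorization in Lyndon words** of a word, computed from right to left as in
Proposition 5.1.6. [cite: Lothaire1997, Theorem 5.1.5; Lothaire1997, Proposition 5.1.6] -/
def lyndonFactorization (w : List α) : List (List α) :=
  lyndonFactorAux w.length w

omit [LinearOrder α] in
/-- Splitting off a right factor: `take (|w| - |m|) w ++ m = w` for a right factor `m`.
[folklore] -/
private theorem take_append_of_suffix {w m : List α} (h : m <:+ w) :
    w.take (w.length - m.length) ++ m = w := by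
  rw [List.suffix_iff_eq_drop] at h
  conv_rhs => rw [← List.take_append_drop (w.length - m.length) w]
  rw [← h]

/-- The fuel does not matter once it is at least `|w|`. [folklore] -/
private theorem lyndonFactorAux_eq : ∀ (n n' : ℕ) (w : List α), w.length ≤ n → w.length ≤ n' →
    lyndonFactorAux n w = lyndonFactorAux n' w
  | 0, n', w, h, h' => by
    obtain rfl : w = [] := List.eq_nil_of_length_eq_zero (Nat.le_zero.1 h)
    cases n' <;> simp [lyndonFactorAux]
  | n + 1, 0, w, h, h' => by
    obtain rfl : w = [] := List.eq_nil_of_length_eq_zero (Nat.le_zero.1 h')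
    simp [lyndonFactorAux]
  | n + 1, n' + 1, w, h, h' => by
    rw [lyndonFactorAux, lyndonFactorAux]
    split_ifs with hw
    · rfl
    · have h0 := List.length_pos_of_ne_nil (minSuffix_ne_nil hw)
      rw [lyndonFactorAux_eq n n' _ (by rw [List.length_take]; omega)
        (by rw [List.length_take]; omega)]

/-- The invariant of the right-to-left factorization: it is a factorization of `w` into Lyndon
words, nonincreasing, all of whose factors are `≥` the smallest nonempty right factor of `w`.
[cite: Lothaire1997, Proposition 5.1.6 (proof)] -/
theorem lyndonFactorAux_spec : ∀ (n : ℕ) (w : List α), w.length ≤ n →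
    (lyndonFactorAux n w).flatten = w ∧ (∀ l ∈ lyndonFactorAux n w, IsLyndon l) ∧
      (lyndonFactorAux n w).Pairwise (fun a b => b ≤ a) ∧
        ∀ l ∈ lyndonFactorAux n w, minSuffix w ≤ l
  | 0, w, h => by
    obtain rfl : w = [] := List.eq_nil_of_length_eq_zero (Nat.le_zero.1 h)
    simp [lyndonFactorAux]
  | n + 1, w, h => by
    rw [lyndonFactorAux]
    split_ifs with hw
    · subst hw
      simp
    · have hm0 : minSuffix w ≠ [] := minSuffix_ne_nil hw
      have hmL : IsLyndon (minSuffix w) := isLyndon_minSuffix hw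
      have hum : w.take (w.length - (minSuffix w).length) ++ minSuffix w = w :=
        take_append_of_suffix (minSuffix_suffix w)
      have hul : (w.take (w.length - (minSuffix w).length)).length ≤ n := by
        rw [List.length_take]
        have := List.length_pos_of_ne_nil hm0
        omega
      obtain ⟨ih1, ih2, ih3, ih4⟩ := lyndonFactorAux_spec n _ hul
      -- the key step of the proof of Proposition 5.1.6: `s ≥ v`
      have hkey : ∀ l ∈ lyndonFactorAux n (w.take (w.length - (minSuffix w).length)),
          minSuffix w ≤ l := by
        intro l hl
        refine le_trans ?_ (ih4 l hl)
        have hu0 : w.take (w.length - (minSuffix w).length) ≠ [] := by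
          intro h0
          rw [h0] at hl
          cases n <;> simp [lyndonFactorAux] at hl
        by_contra hc
        rw [not_le] at hc
        have h1 := hmL.append_lt (minSuffix_ne_nil hu0) hc
        have h2 :
            minSuffix w ≤ minSuffix (w.take (w.length - (minSuffix w).length)) ++ minSuffix w :=
          minSuffix_le (by
            obtain ⟨r, hr⟩ := minSuffix_suffix (w.take (w.length - (minSuffix w).length))
            exact ⟨r, by rw [← List.append_assoc, hr, hum]⟩) (by simp [hm0])
        exact absurd h1 (not_lt.2 h2)
      refine ⟨by simpa [ih1] using hum, ?_, ?_, ?_⟩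
      · intro l hl
        rw [List.mem_append, List.mem_singleton] at hl
        rcases hl with hl | rfl
        exacts [ih2 l hl, hmL]
      · rw [List.pairwise_append]
        exact ⟨ih3, List.pairwise_singleton _ _, fun a ha b hb => by
          rw [List.mem_singleton.1 hb]; exact hkey a ha⟩
      · intro l hl
        rw [List.mem_append, List.mem_singleton] at hl
        rcases hl with hl | rfl
        exacts [hkey l hl, le_rfl]

/-- The factorization of the empty word is empty. [cite: Lothaire1997, Theorem 5.1.5] -/
theorem lyndonFactorization_nil : lyndonFactorization ([] : List α) = [] := by
  rw [lyndonFactorization, List.length_nil, lyndonFactorAux]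

/-- Proposition 5.1.6 as an algorithm: the factorization of a nonempty `w` is that of `w` with its
smallest nonempty right factor removed, followed by that factor ("iterating this process gives the
factorization of `w`"). [cite: Lothaire1997, Proposition 5.1.6 (proof)] -/
theorem lyndonFactorization_eq_append {w : List α} (hw : w ≠ []) :
    lyndonFactorization w =
      lyndonFactorization (w.take (w.length - (minSuffix w).length)) ++ [minSuffix w] := by
  obtain ⟨n, hn⟩ : ∃ n, w.length = n + 1 := ⟨w.length - 1, by
    have := List.length_pos_of_ne_nil hw; omega⟩
  rw [lyndonFactorization, lyndonFactorization,
    show lyndonFactorAux w.length w = lyndonFactorAux (n + 1) w by rw [hn], lyndonFactorAux,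
    if_neg hw]
  have h0 := List.length_pos_of_ne_nil (minSuffix_ne_nil hw)
  rw [lyndonFactorAux_eq n (w.take (w.length - (minSuffix w).length)).length _
    (by rw [List.length_take]; omega) le_rfl]

/-- **Theorem 5.1.5** (existence, i): the factors multiply back to `w`.
[cite: Lothaire1997, Theorem 5.1.5; ChenFoxLyndon1958] -/
theorem flatten_lyndonFactorization (w : List α) : (lyndonFactorization w).flatten = w :=
  (lyndonFactorAux_spec w.length w le_rfl).1

/-- **Theorem 5.1.5** (existence, ii): every factor is a Lyndon word.
[cite: Lothaire1997, Theorem 5.1.5; ChenFoxLyndon1958] -/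
theorem isLyndon_of_mem_lyndonFactorization {w l : List α} (h : l ∈ lyndonFactorization w) :
    IsLyndon l :=
  (lyndonFactorAux_spec w.length w le_rfl).2.1 l h

/-- **Theorem 5.1.5** (existence, iii): the factors are nonincreasing, `l₁ ≥ l₂ ≥ ⋯ ≥ lₙ` (pairwise
form). [cite: Lothaire1997, Theorem 5.1.5; ChenFoxLyndon1958] -/
theorem pairwise_lyndonFactorization (w : List α) :
    (lyndonFactorization w).Pairwise (fun a b => b ≤ a) :=
  (lyndonFactorAux_spec w.length w le_rfl).2.2.1

/-- **Theorem 5.1.5** (existence, iii): the factors are nonincreasing, `l₁ ≥ l₂ ≥ ⋯ ≥ lₙ` (chain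
form). [cite: Lothaire1997, Theorem 5.1.5; ChenFoxLyndon1958] -/
theorem isChain_lyndonFactorization (w : List α) :
    (lyndonFactorization w).IsChain (fun a b => b ≤ a) :=
  (pairwise_lyndonFactorization w).isChain

/-- The smallest nonempty right factor of `w` is `≤` every factor of the factorization.
[cite: Lothaire1997, Proposition 5.1.6] -/
theorem minSuffix_le_of_mem_lyndonFactorization {w l : List α} (h : l ∈ lyndonFactorization w) :
    minSuffix w ≤ l :=
  (lyndonFactorAux_spec w.length w le_rfl).2.2.2 l h

/-- **Proposition 5.1.6**, for an arbitrary nonincreasing factorization into Lyndon words: the last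
factor is `≤` every nonempty right factor of the word. [cite: Lothaire1997, Proposition 5.1.6] -/
theorem getLast_le_of_suffix : ∀ {L : List (List α)} (hL : ∀ l ∈ L, IsLyndon l)
    (hP : L.Pairwise (fun a b => b ≤ a)) (hne : L ≠ []) {v : List α},
    v <:+ L.flatten → v ≠ [] → L.getLast hne ≤ v
  | [], _, _, hne, _, _, _ => absurd rfl hne
  | l :: L', hL, hP, hne, v, hs, hv => by
    rw [List.flatten_cons] at hs
    obtain ⟨t, ht⟩ := hs
    have hlL : IsLyndon l := hL l (by simp)
    rw [List.pairwise_cons] at hP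
    rcases List.append_eq_append_iff.1 ht with ⟨a', rfl, rfl⟩ | ⟨c', rfl, hc⟩
    · -- `v = a' ++ L'.flatten` with `a'` a right factor of `l`
      have hla' : a' ≠ [] → t ++ a' ≤ a' := fun ha' => by
        rcases eq_or_ne t [] with rfl | ht0
        · simp
        · exact (hlL.lt_of_suffix (List.suffix_append t a') ha'
            (ne_append_left_of_ne_nil a' ht0)).le
      rcases eq_or_ne L' [] with rfl | hne'
      · rw [List.flatten_nil, List.append_nil] at hv ⊢
        simpa using hla' hv
      · rw [List.getLast_cons hne']
        rcases eq_or_ne a' [] with rfl | ha'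
        · rw [List.nil_append] at hv ⊢
          exact getLast_le_of_suffix (fun x hx => hL x (List.mem_cons_of_mem _ hx)) hP.2 hne'
            (List.suffix_refl _) hv
        · exact ((hP.1 _ (List.getLast_mem hne')).trans (hla' ha')).trans (self_le_append a' _)
    · -- `v` is a right factor of `L'.flatten`
      have hne' : L' ≠ [] := by
        rintro rfl
        rw [List.flatten_nil] at hc
        exact hv (List.append_eq_nil_iff.1 hc.symm).2
      rw [List.getLast_cons hne']
      exact getLast_le_of_suffix (fun x hx => hL x (List.mem_cons_of_mem _ hx)) hP.2 hne'
        ⟨c', hc.symm⟩ hv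

/-- **Proposition 5.1.6.** In a nonincreasing factorization of a word into Lyndon words, the last
factor is the smallest nonempty right factor of the word. [cite: Lothaire1997, Proposition 5.1.6] -/
theorem getLast_eq_minSuffix {L : List (List α)} (hL : ∀ l ∈ L, IsLyndon l)
    (hP : L.Pairwise (fun a b => b ≤ a)) (hne : L ≠ []) :
    L.getLast hne = minSuffix L.flatten := by
  refine eq_minSuffix ?_ (hL _ (List.getLast_mem hne)).1
    (fun v hs hv => getLast_le_of_suffix hL hP hne hs hv)
  conv_rhs => rw [← List.dropLast_append_getLast hne]
  rw [List.flatten_append, List.flatten_singleton]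
  exact List.suffix_append _ _

/-- The last factor of `lyndonFactorization w` is the smallest nonempty right factor of `w`.
[cite: Lothaire1997, Proposition 5.1.6] -/
theorem getLast_lyndonFactorization {w : List α} (hne : lyndonFactorization w ≠ []) :
    (lyndonFactorization w).getLast hne = minSuffix w := by
  rw [getLast_eq_minSuffix (fun l hl => isLyndon_of_mem_lyndonFactorization hl)
    (pairwise_lyndonFactorization w) hne, flatten_lyndonFactorization]

omit [LinearOrder α] in
/-- A list of nonempty words with empty product is empty. [folklore] -/
private theorem eq_nil_of_flatten_eq_nil {L : List (List α)} (hL : ∀ l ∈ L, l ≠ [])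
    (h : L.flatten = []) : L = [] := by
  rcases L with _ | ⟨l, L'⟩
  · rfl
  · rw [List.flatten_cons, List.append_eq_nil_iff] at h
    exact absurd h.1 (hL l (by simp))

/-- Uniqueness in Theorem 5.1.5, by induction on the length of the word (peeling the last factor,
which is determined by Proposition 5.1.6). [cite: Lothaire1997, Theorem 5.1.5 (proof)] -/
private theorem eq_of_flatten_eq_aux : ∀ (n : ℕ) {L L' : List (List α)}, L.flatten.length ≤ n →
    (∀ l ∈ L, IsLyndon l) → L.Pairwise (fun a b => b ≤ a) → (∀ l ∈ L', IsLyndon l) →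
    L'.Pairwise (fun a b => b ≤ a) → L.flatten = L'.flatten → L = L'
  | 0, L, L', hn, hL, _, hL', _, he => by
    have h0 : L.flatten = [] := List.eq_nil_of_length_eq_zero (Nat.le_zero.1 hn)
    rw [eq_nil_of_flatten_eq_nil (fun l hl => (hL l hl).1) h0,
      eq_nil_of_flatten_eq_nil (fun l hl => (hL' l hl).1) (he ▸ h0)]
  | n + 1, L, L', hn, hL, hP, hL', hP', he => by
    rcases eq_or_ne L [] with rfl | hne
    · rw [List.flatten_nil] at he
      exact (eq_nil_of_flatten_eq_nil (fun l hl => (hL' l hl).1) he.symm).symm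
    · have hne' : L' ≠ [] := by
        rintro rfl
        rw [List.flatten_nil] at he
        exact hne (eq_nil_of_flatten_eq_nil (fun l hl => (hL l hl).1) he)
      have hlast : L.getLast hne = L'.getLast hne' := by
        rw [getLast_eq_minSuffix hL hP hne, getLast_eq_minSuffix hL' hP' hne', he]
      have hd := List.dropLast_append_getLast hne
      have hd' := List.dropLast_append_getLast hne'
      have hfl : L.dropLast.flatten = L'.dropLast.flatten := by
        have h1 := he
        rw [← hd, ← hd', List.flatten_append, List.flatten_append, List.flatten_singleton,
          List.flatten_singleton, hlast] at h1
        exact List.append_cancel_right h1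
      have hlen : L.dropLast.flatten.length ≤ n := by
        have h1 : (L.dropLast ++ [L.getLast hne]).flatten.length ≤ n + 1 := by rw [hd]; exact hn
        rw [List.flatten_append, List.flatten_singleton, List.length_append] at h1
        have := List.length_pos_of_ne_nil (hL _ (List.getLast_mem hne)).1
        omega
      have := eq_of_flatten_eq_aux n hlen (fun l hl => hL l (List.mem_of_mem_dropLast hl))
        (hP.sublist (List.dropLast_sublist L)) (fun l hl => hL' l (List.mem_of_mem_dropLast hl))
        (hP'.sublist (List.dropLast_sublist L')) hfl
      rw [← hd, ← hd', this, hlast]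

/-- **Theorem 5.1.5** (uniqueness): two nonincreasing factorizations into Lyndon words of the same
word coincide ("`l₁ = l'₁`, and the result follows by induction"; here peeled from the right with
Proposition 5.1.6). [cite: Lothaire1997, Theorem 5.1.5; ChenFoxLyndon1958] -/
theorem eq_of_flatten_eq {L L' : List (List α)} (hL : ∀ l ∈ L, IsLyndon l)
    (hP : L.Pairwise (fun a b => b ≤ a)) (hL' : ∀ l ∈ L', IsLyndon l)
    (hP' : L'.Pairwise (fun a b => b ≤ a)) (he : L.flatten = L'.flatten) : L = L' :=
  eq_of_flatten_eq_aux _ le_rfl hL hP hL' hP' he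

/-- **Theorem 5.1.5** (uniqueness): any nonincreasing factorization of `w` into Lyndon words is
`lyndonFactorization w`. [cite: Lothaire1997, Theorem 5.1.5; ChenFoxLyndon1958] -/
theorem eq_lyndonFactorization {w : List α} {L : List (List α)} (hL : ∀ l ∈ L, IsLyndon l)
    (hP : L.Pairwise (fun a b => b ≤ a)) (hw : L.flatten = w) : L = lyndonFactorization w :=
  eq_of_flatten_eq hL hP (fun _ hl => isLyndon_of_mem_lyndonFactorization hl)
    (pairwise_lyndonFactorization w) (hw.trans (flatten_lyndonFactorization w).symm)

/-- **Theorem 5.1.5 (Lyndon; Chen–Fox–Lyndon).** Any word may be written uniquely as a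
nonincreasing product of Lyndon words `w = l₁ l₂ ⋯ lₙ`, `lᵢ ∈ L`, `l₁ ≥ l₂ ≥ ⋯ ≥ lₙ` (`n = 0` for
`w = ε`). [cite: Lothaire1997, Theorem 5.1.5; ChenFoxLyndon1958] -/
theorem existsUnique_lyndonFactorization (w : List α) :
    ∃! L : List (List α), (∀ l ∈ L, IsLyndon l) ∧ L.Pairwise (fun a b => b ≤ a) ∧ L.flatten = w :=
  ⟨lyndonFactorization w, ⟨fun _ hl => isLyndon_of_mem_lyndonFactorization hl,
    pairwise_lyndonFactorization w, flatten_lyndonFactorization w⟩,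
    fun _ h => eq_lyndonFactorization h.1 h.2.1 h.2.2⟩

/-- The factorization of a Lyndon word is the word itself (`n = 1`).
[cite: Lothaire1997, Theorem 5.1.5] -/
theorem IsLyndon.lyndonFactorization_eq {w : List α} (hw : IsLyndon w) :
    lyndonFactorization w = [w] :=
  (eq_lyndonFactorization (L := [w]) (fun l hl => by rwa [List.mem_singleton.1 hl])
    (List.pairwise_singleton _ _) (List.flatten_singleton)).symm

/-- A Lyndon word is its own smallest nonempty right factor (Proposition 5.1.2).
[cite: Lothaire1997, Proposition 5.1.2; Lothaire1997, Proposition 5.1.6] -/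
theorem IsLyndon.minSuffix_eq {w : List α} (hw : IsLyndon w) : minSuffix w = w :=
  (eq_minSuffix (List.suffix_refl w) hw.1 fun v hs hv => by
    rcases eq_or_ne v w with rfl | hne
    · exact le_rfl
    · exact (hw.lt_of_suffix hs hv hne).le).symm

/-! ### Examples (`A = {a < b}` rendered as `0 < 1` in `ℕ`) -/

/-- Example 5.1.1: `a, b, ab, aab, abb, aaab, aabb, abbb, aaaab, aaabb, aabab` are Lyndon words.
[cite: Lothaire1997, Example 5.1.1] -/
example : IsLyndon [0] ∧ IsLyndon [1] ∧ IsLyndon [0, 1] ∧ IsLyndon [0, 0, 1] ∧ IsLyndon [0, 1, 1] ∧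
    IsLyndon [0, 0, 0, 1] ∧ IsLyndon [0, 0, 1, 1] ∧ IsLyndon [0, 1, 1, 1] ∧
    IsLyndon [0, 0, 0, 0, 1] ∧ IsLyndon [0, 0, 0, 1, 1] ∧ IsLyndon [0, 0, 1, 0, 1] := by decide

/-- … and these are all the Lyndon words of length at most `4` over `{a < b}`: the other words of
length `2`, `3`, `4` listed here are not Lyndon words (`aa`, `ba`, `bb`; `aba`, `baa`, `bab`, …;
`abab` is not primitive, `abba > aabb` is not minimal among its conjugates).
[cite: Lothaire1997, Example 5.1.1] -/
example : ¬IsLyndon ([] : List ℕ) ∧ ¬IsLyndon [0, 0] ∧ ¬IsLyndon [1, 0] ∧ ¬IsLyndon [1, 1] ∧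
    ¬IsLyndon [0, 1, 0] ∧ ¬IsLyndon [1, 0, 0] ∧ ¬IsLyndon [1, 0, 1] ∧ ¬IsLyndon [0, 0, 0] ∧
    ¬IsLyndon [0, 1, 0, 1] ∧ ¬IsLyndon [0, 1, 1, 0] ∧ ¬IsLyndon [0, 1, 0, 0] := by decide

/-- The number of Lyndon words of length `n` over two letters is `2, 1, 2, 3, 6` for
`n = 1, …, 5` (`(1/n) Σ_{d ∣ n} μ(d) 2^{n/d}`). [cite: Lothaire1997, §5.1 (Card(L ∩ Aⁿ))] -/
example : ((List.range 5).map fun n =>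
    (((List.range (2 ^ (n + 1))).map fun i =>
      (List.range (n + 1)).map fun j => i / 2 ^ j % 2).filter
        fun w => decide (IsLyndon w)).length) = [2, 1, 2, 3, 6] := by decide

/-- The standard factorization `σ(aabb) = (a, abb)` (the right factor of maximal length in `L`),
although also `aabb = (aab)(b)` with `aab < b` in `L`. [cite: Lothaire1997, §5.1 (standard
factorization)] -/
example : stdLeft [0, 0, 1, 1] = [0] ∧ stdRight [0, 0, 1, 1] = [0, 1, 1] ∧
    IsLyndon [0, 0, 1] ∧ IsLyndon [1] ∧ [0, 0, 1] < [1] := by decide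

/-- A factorization in Lyndon words: `abaabbaba = (ab)(aabbab)(a)` with `ab ≥ aabbab ≥ a`, and the
last factor `a` is the smallest right factor. [cite: Lothaire1997, Theorem 5.1.5; Lothaire1997,
Proposition 5.1.6] -/
example : lyndonFactorization [0, 1, 0, 0, 1, 1, 0, 1, 0] = [[0, 1], [0, 0, 1, 1, 0, 1], [0]] ∧
    minSuffix [0, 1, 0, 0, 1, 1, 0, 1, 0] = [0] ∧ [0, 0, 1, 1, 0, 1] ≤ [0, 1] ∧
    [0] ≤ [0, 0, 1, 1, 0, 1] := by decide

/-- The factorization of a Lyndon word is the word itself; that of a nonincreasing word is its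
letters: `aabab = (aabab)`, `bbaa = (b)(b)(a)(a)`. [cite: Lothaire1997, Theorem 5.1.5] -/
example : lyndonFactorization [0, 0, 1, 0, 1] = [[0, 0, 1, 0, 1]] ∧
    lyndonFactorization [1, 1, 0, 0] = [[1], [1], [0], [0]] := by decide

end Literature.Combinatorics.Words
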